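import Literature.AlgebraicGeometry.Frobenioids.ArchimedeanPerfectionUnitTransportVal
import Literature.AlgebraicGeometry.Frobenioids.BiratUnitsIntertwines
import HarnessLib

/-!
# Frobenioids II, Thm. 3.6 (i)/(v) at `Λ = ℚ`, piece P2 (vii): `(T-unit)` — transport of the unit coordinate along
# linear arrows of `C^pf`, with the Galois-twist bookkeeping of `Base ψ` and of the structure isomorphisms

Mochizuki, *The geometry of Frobenioids II: poly-Frobenioids*, Kyushu J. Math. **62** (2008) 401–460, §3,
Thm. 3.6 (i)/(v) p. 36–37 [cite: MochizukiFrdII2008, Thm 3.6 (v) p.37]; [FrdI] Prop. 2.2 (ii)(a) p. 45,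
Prop. 4.4 (iv) p. 83 [cite: MochizukiFrdI2008, Prop. 4.4 (iv) p.83].

abc-iut cell, layer L1, row M13-c3 FILE A-4 (seat abc-iut-w5-d246), file 2h: the twist identity
`τ_a ⊻ twists(Base ψ₀) ⊻ τ_b = twists(ι_X) ⊻ twists(ι_{X′}) ⊻ twists(π (Base ψ))` (from the compatibility squares
`w` of the three arrows `frob_a`, `ψ₀`, `frob_b` of `C = C₀ ×_{D₀} D`), and the resulting **`(T-unit)`**:
for `ψ : X → X′` linear and `w′ ∈ O^×_{K′}` (`K′ = π(Base A′)`), the units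
`(unitsPerfEquiv X [ι_X^*ψ^* w′])^{X.idx}` and `(unitsPerfEquiv X′ [ι_{X′}^* w′])^{X′.idx}` are intertwined along `ψ`,
where `ψ^* = unitPull (π (Base ψ))` and `ι^* = twistUnit (twists X.obj.iso.hom)` reads a unit scalar on the
`C₀`-side base through the structure isomorphism (**`intertwines_unitsPerfEquiv_pow_pull`**).  One def
(`twistUnit`); nothing here bears on [IUTchIII] Cor. 3.12.
-/

noncomputable section

namespace Literature.AlgebraicGeometry.Frobenioids

open CategoryTheory Opposite
open scoped NNReal

universe v u

namespace ArchFrd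

/-! ### Twist calculus in `D₀` (complex targets) -/

namespace D0

/-- Twists add under composition when the final target is complex. [cite: MochizukiFrdII2008, Def 3.1 (i) p.23] -/
theorem twists_comp_of_isComplex {M L K : D0} (f : M ⟶ L) (g : L ⟶ K) (hK : K.IsComplex) :
    Hom.twists (f ≫ g) = xor (Hom.twists f) (Hom.twists g) := by
  unfold IsComplex at hK
  subst hK
  exact twists_comp_complex f g

/-- Reading a unit scalar through a Galois twist (`σ = twists ι` for a structure isomorphism `ι`): `u ↦ σ(u)`,
an automorphism of `O_K^×`. [cite: MochizukiFrdII2008, Def 3.1 (ii) p.23] -/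
def twistUnit (σ : Bool) (K : D0) : unitScalars K →* unitScalars K where
  toFun u := ⟨galAct σ (u : ℂˣ), galAct_mem_scalars σ u.2.1, by rw [norm_galAct]; exact u.2.2⟩
  map_one' := Subtype.ext (map_one _)
  map_mul' a b := Subtype.ext (map_mul _ _ _)

/-- `twistUnit σ u = σ(u)` on `ℂˣ`. [cite: MochizukiFrdII2008, Def 3.1 (ii) p.23] -/
@[simp] theorem coe_twistUnit (σ : Bool) (K : D0) (u : unitScalars K) :
    ((twistUnit σ K u : unitScalars K) : ℂˣ) = galAct σ (u : ℂˣ) := rfl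

end D0

namespace Thm36Sub

variable {D : Type u} [Category.{v} D] {π : D ⥤ D0}

open PreFrobenioid PreFrobenioid.Perfection

/-- **The compatibility square of an arrow of `C = C₀ ×_{D₀} D`, on twists**: for `f : S → T` with `π(T)` complex,
`twists(Base f₀) ⊻ twists(ι_T) = twists(ι_S) ⊻ twists(π f_D)`. [cite: MochizukiFrdII2008, Def 3.1 (iii) p.24] -/
theorem twists_w {S T : C π} (f : S ⟶ T) (hT : (π.obj T.snd).IsComplex) :
    xor (D0.Hom.twists (C0.Base f.fst)) (D0.Hom.twists T.iso.hom) =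
      xor (D0.Hom.twists S.iso.hom) (D0.Hom.twists (π.map f.snd)) := by
  have w := f.w
  change C0.Base f.fst ≫ T.iso.hom = S.iso.hom ≫ π.map f.snd at w
  have h := congrArg D0.Hom.twists w
  rw [D0.twists_comp_of_isComplex _ _ hT] at h
  exact h.trans (D0.twists_comp_of_isComplex _ _ hT)

/-- Bookkeeping: the `𝔽₂`-linear consequence of the three compatibility squares. [cite: MochizukiFrdII2008, Def 3.1 (iii) p.24] -/
theorem bool_twist (t1 t2 t3 p1 p2 p3 iX iX' iA iB : Bool) (E1 : (xor t1 iA) = (xor iX p1))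
    (E2 : (xor t2 iB) = (xor iA p2)) (E3 : (xor t3 iB) = (xor iX' p3)) :
    (xor iX' (xor t1 (xor t2 t3))) = (xor (xor p1 (xor p2 p3)) iX) := by
  revert E1 E2 E3
  cases t1 <;> cases t2 <;> cases t3 <;> cases p1 <;> cases p2 <;> cases p3 <;> cases iX <;> cases iX' <;>
    cases iA <;> cases iB <;> decide

section Twist

variable {hF : PreFrobenioid.IsFrobenioid (C.toElem π)} (X X' : pfCat π hF) {a b : ℕ+} (e : X.idx * a = X'.idx * b)

/-- **The twist identity**: for `ψ = [ψ₀]`, `ψ₀ : A^{(a)} → A′^{(b)}`, with `π(Base A′)` complex,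
`τ_a ⊻ twists(Base ψ₀) ⊻ τ_b` acts on unit scalars as `twists(ι_X) ∘ twists(π Base ψ) ∘ twists(ι_{X′})`.
[cite: MochizukiFrdII2008, Thm 3.6 (v) p.37] -/
theorem galAct_levelTwists_eq (ψ₀ : frobPow hF X.obj a ⟶ frobPow hF X'.obj b) (hK' : (π.obj X'.obj.snd).IsComplex)
    (u : ℂˣ) :
    D0.galAct (xor (levelTwist X a) (xor (D0.Hom.twists (C0.Base ψ₀.fst :)) (levelTwist X' b)))
        (D0.galAct (D0.Hom.twists X'.obj.iso.hom) u) =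
      D0.galAct (D0.Hom.twists X.obj.iso.hom)
        (D0.galAct (D0.Hom.twists (π.map (Base (pfStr π hF) (Hom.mk (⟨⟨a, b, e⟩, ψ₀⟩ : Rep X X'))))) u) := by
  -- complexness of the `D₀`-objects involved
  have hB' : (π.obj (frobPow hF X'.obj b).snd).IsComplex :=
    D0.isComplex_of_hom (π.map (baseInvFrob hF X'.obj b)) hK'
  have hB : (π.obj (frobPow hF X.obj a).snd).IsComplex := D0.isComplex_of_hom (π.map ψ₀.snd) hB'
  -- the three squares and the base of `[ψ₀]`
  have E1 := twists_w (frob hF X.obj a) hB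
  have E2 := twists_w ψ₀ hB'
  have E3 := twists_w (frob hF X'.obj b) hB'
  -- `twists (π Base(frob_b)⁻¹) = twists (π frob_b)`
  have E0 : D0.Hom.twists (π.map (baseInvFrob hF X'.obj b)) = D0.Hom.twists (π.map (frob hF X'.obj b).snd) := by
    have h := congrArg D0.Hom.twists
      (show π.map (frob hF X'.obj b).snd ≫ π.map (baseInvFrob hF X'.obj b) = 𝟙 _ by
        rw [← Functor.map_comp]
        exact (congrArg π.map (base_frob_baseInvFrob hF X'.obj b)).trans (π.map_id _))
    have h2 := (D0.twists_comp_of_isComplex (π.map (frob hF X'.obj b).snd) (π.map (baseInvFrob hF X'.obj b))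
      hK').symm.trans (h.trans (D0.twists_id _))
    have hb : ∀ t r : Bool, xor t r = false → r = t := by decide
    exact hb _ _ h2
  have E4 : D0.Hom.twists (π.map (Base (pfStr π hF) (Hom.mk (⟨⟨a, b, e⟩, ψ₀⟩ : Rep X X')))) =
      xor (D0.Hom.twists (π.map (frob hF X.obj a).snd))
        (xor (D0.Hom.twists (π.map ψ₀.snd)) (D0.Hom.twists (π.map (frob hF X'.obj b).snd))) := by
    change D0.Hom.twists (π.map ((frob hF X.obj a).snd ≫ ψ₀.snd ≫ baseInvFrob hF X'.obj b)) = _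
    rw [Functor.map_comp, Functor.map_comp]
    refine (D0.twists_comp_of_isComplex _ _ hK').trans ?_
    exact congrArg (xor _) ((D0.twists_comp_of_isComplex _ _ hK').trans (congrArg (xor _) E0))
  rw [← D0.galAct_xor, ← D0.galAct_xor, E4]
  unfold levelTwist
  exact congrArg (fun σ => D0.galAct σ u) (bool_twist _ _ _ _ _ _ _ _ _ _ E1 E2 E3)

end Twist

/-! ### `(T-unit)` -/

/-- Torsion unit scalars are trivial in the perfection: `u² = 1 ⇒ [u] = 1` in `(O_K^×)^pf`.
[cite: MochizukiFrdI2008, §0 p.11] -/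
theorem perfection_of_eq_one_of_sq {K : D0} (u : D0.unitScalars K) (h : (u : ℂˣ) ^ 2 = 1) :
    Frobenioids.Perfection.of (D0.unitScalars K) u = 1 := by
  rw [Frobenioids.Perfection.of_apply, Frobenioids.Perfection.mk_eq_one_iff]
  exact ⟨2, Subtype.ext (by rw [SubgroupClass.coe_pow]; exact h)⟩

/-- **`(T-unit)` — transport of the unit coordinate along linear arrows of `C^pf`**: for `ψ : X → X′` linear and
`w′ ∈ O^×_{π(Base A′)}`, the units `(unitsPerfEquiv X [ι_X^* ψ^* w′])^{X.idx}` of `X` and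
`(unitsPerfEquiv X′ [ι_{X′}^* w′])^{X′.idx}` of `X′` satisfy `ψ ∘ u = u′ ∘ ψ` in `C^birat`; here
`ψ^* = unitPull (π (Base ψ))`, `ι_X^* = twistUnit (twists ι_X)` (structure isomorphism of `X`), and the exponents
`X.idx`, `X′.idx` are forced by `n·a = n′·b` (cf. the divisor side, where `Div` of `C^pf` carries the factor
`1/(X.idx · level)`).  [cite: MochizukiFrdII2008, Thm 3.6 (v) p.37] -/
theorem intertwines_unitsPerfEquiv_pow_pull {hF : PreFrobenioid.IsFrobenioid (C.toElem π)} {X X' : pfCat π hF}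
    (hPf : PreFrobenioid.IsFrobenioid (pfStr π hF)) (ψ : X ⟶ X') (hψ : IsLinear (pfStr π hF) ψ)
    (w' : D0.unitScalars (π.obj X'.obj.snd)) :
    BiratUnits.Intertwines hPf ψ
      (BiratUnits.unitsToBirat hPf X ((unitsPerfEquiv X (Frobenioids.Perfection.of (D0.unitScalars (π.obj X.obj.snd))
        (D0.twistUnit (D0.Hom.twists X.obj.iso.hom) (π.obj X.obj.snd)
          (D0.unitPull (π.map (Base (pfStr π hF) ψ)) w')))) ^ (X.idx : ℕ)))
      (BiratUnits.unitsToBirat hPf X' ((unitsPerfEquiv X' (Frobenioids.Perfection.of (D0.unitScalars (π.obj X'.obj.snd))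
        (D0.twistUnit (D0.Hom.twists X'.obj.iso.hom) (π.obj X'.obj.snd) w'))) ^ (X'.idx : ℕ))) := by
  have hsq := PreFrobenioid.hasBiratSquares_of_isFrobenioid hPf
  rcases D0.isReal_or_isComplex (π.obj X'.obj.snd) with hR | hK'
  · -- real base: `w′ = ±1`, all the units are trivial
    have h2 : ((w' : ℂˣ)) ^ 2 = 1 := by
      have hm : (w' : ℂˣ) ∈ D0.scalars D0.real :=
        (congrArg (fun K : D0 => (w' : ℂˣ) ∈ D0.scalars K) hR).mp w'.2.1
      exact sq_eq_one_of_mem_scalars_real hm w'.2.2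
    have e1 : Frobenioids.Perfection.of (D0.unitScalars (π.obj X'.obj.snd))
        (D0.twistUnit (D0.Hom.twists X'.obj.iso.hom) (π.obj X'.obj.snd) w') = 1 :=
      perfection_of_eq_one_of_sq _ (by rw [D0.coe_twistUnit, ← map_pow, h2, map_one])
    have e2 : Frobenioids.Perfection.of (D0.unitScalars (π.obj X.obj.snd))
        (D0.twistUnit (D0.Hom.twists X.obj.iso.hom) (π.obj X.obj.snd)
          (D0.unitPull (π.map (Base (pfStr π hF) ψ)) w')) = 1 :=
      perfection_of_eq_one_of_sq _ (by rw [D0.coe_twistUnit, D0.coe_unitPull, ← map_pow, ← map_pow, h2, map_one, map_one])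
    have u1 : unitsPerfEquiv X' (Frobenioids.Perfection.of (D0.unitScalars (π.obj X'.obj.snd))
        (D0.twistUnit (D0.Hom.twists X'.obj.iso.hom) (π.obj X'.obj.snd) w')) = 1 := by
      rw [e1]; exact (unitsPerfEquiv X').map_one
    have u2 : unitsPerfEquiv X (Frobenioids.Perfection.of (D0.unitScalars (π.obj X.obj.snd))
        (D0.twistUnit (D0.Hom.twists X.obj.iso.hom) (π.obj X.obj.snd)
          (D0.unitPull (π.map (Base (pfStr π hF) ψ)) w'))) = 1 := by
      rw [e2]; exact (unitsPerfEquiv X).map_one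
    rw [u1, u2, one_pow, one_pow, map_one, map_one]
    exact BiratUnits.Intertwines.one hsq ψ
  · -- complex base: adapted isotropic levels, the rotations, and the twist identity
    obtain ⟨⟨⟨a₀, b₀, e₀⟩, ψ₀⟩, rfl⟩ := exists_rep ψ
    obtain ⟨c, hc⟩ := exists_isotropic_levels X
    obtain ⟨c', hc'⟩ := exists_isotropic_levels X'
    have ha := hc (c * (a₀ * c')) (dvd_mul_right _ _)
    have hb := hc' (c' * (b₀ * c)) (dvd_mul_right _ _)
    have e : X.idx * (c * (a₀ * c')) = X'.idx * (c' * (b₀ * c)) := by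
      rw [mul_left_comm c a₀ c', ← mul_assoc, e₀, mul_assoc, mul_left_comm c' b₀ c, mul_comm c c']
    have hle : (⟨a₀, b₀, e₀⟩ : Level X X').LE ⟨c * (a₀ * c'), c' * (b₀ * c), e⟩ :=
      ⟨dvd_mul_of_dvd_right (dvd_mul_right a₀ c') c, dvd_mul_of_dvd_right (dvd_mul_right b₀ c) c'⟩
    rw [← Hom.mk_lift ⟨⟨a₀, b₀, e₀⟩, ψ₀⟩ ⟨c * (a₀ * c'), c' * (b₀ * c), e⟩ hle]
    have hlin : C0.degFr (Level.lift (⟨a₀, b₀, e₀⟩ : Level X X') ⟨c * (a₀ * c'), c' * (b₀ * c), e⟩ hle ψ₀).fst = 1 := by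
      have h1 : Rep.degFr (⟨⟨a₀, b₀, e₀⟩, ψ₀⟩ : Rep X X') = 1 := hψ
      have := degFr_lift (⟨a₀, b₀, e₀⟩ : Level X X') ⟨c * (a₀ * c'), c' * (b₀ * c), e⟩ hle ψ₀
      rw [h1] at this
      exact this
    have hK : (π.obj X.obj.snd).IsComplex :=
      D0.isComplex_of_hom (π.map (Base (pfStr π hF) (Hom.mk (⟨⟨a₀, b₀, e₀⟩, ψ₀⟩ : Rep X X')))) hK'
    refine intertwines_unitsPerfEquiv_pow X X' hPf e ha hb _ hlin (isComplexObj_frobPow X hK _)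
      (isComplexObj_frobPow X' hK' _) _ _ ?_
    rw [D0.coe_twistUnit, D0.coe_twistUnit, D0.coe_unitPull, galAct_levelTwists_eq X X' e _ hK',
      Hom.mk_lift ⟨⟨a₀, b₀, e₀⟩, ψ₀⟩ ⟨c * (a₀ * c'), c' * (b₀ * c), e⟩ hle]

end Thm36Sub

end ArchFrd

end Literature.AlgebraicGeometry.Frobenioids

end
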